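import Literature.MathematicalPhysics.QuantumFieldTheory.Balaban1983to89.B9Cor35ComparisonsGpCAtLetters
import Literature.MathematicalPhysics.QuantumFieldTheory.Balaban1983to89.Node00.OpsYTransport
import Literature.MathematicalPhysics.QuantumFieldTheory.Balaban1983to89.B9Cor35AtOneInverseLetters

/-!
# NODE 00 — the GENUINE covariant operator `Δ′_a(U)` of [B9] (3.24) and the letter `G′(U) = (Δ′_a(U))⁻¹` (v2 bricks P3–P4)

[B9] p. 394: *"Let us introduce the operator `Δ′_a = Δ′_a(U) = (Δ_{η,U} + Q′*aQ′)|_{Ω₀}` where `Q′*aQ′` is defined by the same quadratic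
form as in (2.14), i.e. `⟨λ, Q′*aQ′λ⟩ = Σ_{j=0}^{k} a_j Σ_{y ∈ Λ_j} (L^jη)^{d−2} |(Q′_j(U)λ)(y)|²` (3.24) … Its inverse is denoted by
`G′`, or `G′(U)`"*; p. 395: *"It coincides with `Δ_a` in (2.19) if `U = 1`"*; (3.19): `(Q′_j(U)λ)(y) = Σ_{x ∈ B^j(y)} L^{−jd} R(U(Γ^j_{y,x})) λ(x)`.

v1 (`Node00.OpsYOfLetters`) takes `G′(U)` as a LETTER `CovLettersY.Gp : CfgY → (SiteY → 𝔸) →ₗ[ℂ] (SiteY → 𝔸)` with the printed `U = 1`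
clause `Gp_one` as a `Prop` field.  This module CONSTRUCTS the operator and the letter, on NODE 00's carrier (the box chart `SiteY i` of the
member's torus, whose flat `Δ′_a` IS NODE 00's genuine matrix `B6MultiLevelTorusOperator.mlOpT` with inverse `KTIdx.G = gmlT`):

* §1 generic: the KERNEL OPERATOR WITH TRANSPORT `kernelTrOpY K T : Λ ↦ (z ↦ Σ_w K(z,w) • R(T(z,w)) Λ(w))` (ℂ-linear), its `T = 1` face
  `= liftOpY (Matrix.of K)`; the lift adds (`liftOpY_add`) — the rest of the lift calculus (operators determined on product-form lifts, the lift
  multiplicative, units lift to units, clause transfer through `Ring.inverse`) is n06-g's `B9Cor35AtOneInverseLetters`, imported;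
* §2 the covariant Laplacian of v1 as a ℂ-linear map `lapSL i U` (additivity ∕ homogeneity of `cdS`, `cdsS`, `lapS`);
* §3 ★ `deltaPrimeAY i par U := lapSL i U + kernelTrOpY (avgCoeffY i) (avgTrY i par U)` — the Laplacian `Δ_U` plus the AVERAGING TERM in
  NODE 00's collapsed-kernel form (`mlOpT_apply`: `Δ′_a(z,w) = (−Δ^{per})(z,w) + levC_{lev z}·[w ∼_{lev z} z]`), made covariant by the transporter
  `U(Γ_{z,c}) U(Γ_{c,w})` THROUGH THE CORNER `c = cornerY i (lev z) z` of the common `L^{lev z}`-block (print's `Q′_j(U)* 1_{Λ_j} Q′_j(U)`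
  transports `w → y → z` through the block's reference point `y`; (3.19)), for ANY transporter letter `par : SiteParY 𝔸 i` (the genuine one is
  `Node00.parSY` of `OpsYTransport`); its `U = 1` face ★ `deltaPrimeAY_one : deltaPrimeAY i par 1 = liftOpY (mlOpT …)` under `par 1 = 1`;
* §4 ★ the GENUINE LETTER `GpY i par : SiteOpY 𝔸 i := fun U => Ring.inverse (deltaPrimeAY i par U)` — `G′(U) = (Δ′_a(U))⁻¹` wherever
  `Δ′_a(U)` is invertible (Thm 3.1's regime), `0` elsewhere — with the printed clause PROVED: ★ `GpY_one : GpY i par 1 = liftOpY (KTIdx.G)`,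
  `GpY_one_liftY : GpY i par 1 (f ⊗ E) = (G f) ⊗ E` (via n06-g's transfer lemmas), and the inverse laws `deltaPrimeAY_mul_GpY` ∕ `GpY_mul_deltaPrimeAY`
  under `IsUnit (Δ′_a(U))` (`isUnit_deltaPrimeAY_one` at `U = 1`);
* §5 the UPGRADE `CovLettersY.withGp 𝔏` replacing a letter family's `Gp` by `GpY _ 𝔏.parS` (clause `Gp_one` discharged by §4), and the
  family `covLettersY_TGp x := ((covLettersY_flat).withTransport).withGp` with GENUINE transport (`Node00.OpsYTransport`) and GENUINE `G′(U)`.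

HONEST LIMITS.  (i) Print's averaging term goes through the hierarchy of block centres (composite contours `Γ^j_{y,x}` of [5] (52)–(53)) and
restricts to `Ω₀` with Dirichlet conditions; here the carrier is NODE 00's torus `T_η = Ω₁` (no `Ω₀`-restriction at NODE 00's index: the flat
face is LITERALLY `mlOpT`), the reference point is the block's corner and the contour is `par`'s — modelling choices that agree with print at
`U = 1` and differ at `U ≠ 1` by plaquette holonomies inside one block.  (ii) Invertibility of `Δ′_a(U)` for `U` in the regular set (3.35) is
THEOREM 3.1's content and is NOT proved here (`GpY` is `Ring.inverse`, `= 0` off the invertible set).  (iii) Nothing continuum, OS, gap, Clay.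

[cite: Balaban1985BackgroundPropagators, (3.19) p.393, (3.23)–(3.25) pp.394–395, Thm 3.1 p.397, Cor. 3.5 p.407; Balaban1984PropagatorsII, (2.13)–(2.14) p.225]

(Locator edition 2026-08-28: «(3.23)», «(3.24)», «(3.25)» and `G′ = (Δ′_a)⁻¹` are printed on p. 394 (the page owner's read); the bare «p. 395» locators kept are the positivity ∕ «coincides with Δ_a if U = 1» remarks and (3.26)–(3.27), which are on p. 395; locators only, no declaration changed.)
-/

namespace Literature.MathematicalPhysics.QuantumFieldTheory.Balaban1983to89.Node00

open B4Reflection242 (boxDom mem_boxDom blk avgK)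
open B6MultiLevelBoxOperator (levC aPrinted)
open B6MultiLevelTorusOperator (mlOpT gmlT perLapT)
open B6KLevelCensusIndexV1 (KIdx)
open B6Prop22KLevelTorusCensus (KTIdx)
open B9Eq39Adjoint (R R_one R_add R_smul R_mul)
open B9PinMembersKLevelV1 (MemberY)
open B9Cor35ComparisonsGpCAtLetters (lapS_one_liftY)
open B9Cor35AtOneInverseLetters (linearMap_ext_of_liftY isUnit_mlOpT isUnit_of_liftY_clause_mulVec eq_liftOpY_G_of_ringInverse
  Gp_one_of_ringInverse_deltaPrimeA_one)
open scoped Matrix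

noncomputable section

variable {d ℓ : ℕ} {hd : 1 ≤ d + 1} {hL : Odd (ℓ + 1) ∧ 1 < ℓ + 1} {b₀ b₁ : ℝ} {Mstar : ℕ}
variable {𝔸 : Type} [NormedRing 𝔸] [NormedAlgebra ℂ 𝔸] [CompleteSpace 𝔸]

/-! ## §1 Kernel operators with transport; operators are determined on lifts; the lift is multiplicative -/

section General

variable {X : Type} [Fintype X]

/-- the KERNEL OPERATOR WITH TRANSPORT: `(K♯_T Λ)(z) = Σ_w K(z,w) • R(T(z,w)) Λ(w)` — a real kernel `K` and a transporter `T(z,w) ∈ 𝔸ˣ` acting by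
the adjoint representation `R`. [cite: Balaban1985BackgroundPropagators, (3.19) p.393, (3.24) p.394] -/
def kernelTrOpY (K : X → X → ℝ) (T : X → X → 𝔸ˣ) : (X → 𝔸) →ₗ[ℂ] (X → 𝔸) where
  toFun Λ := fun z => ∑ w, ((K z w : ℝ) : ℂ) • R (T z w) (Λ w)
  map_add' Λ Λ' := by
    funext z
    simp only [Pi.add_apply, R_add, smul_add, Finset.sum_add_distrib]
  map_smul' c Λ := by
    funext z
    simp only [Pi.smul_apply, R_smul, RingHom.id_apply, Finset.smul_sum, smul_comm c]

omit [CompleteSpace 𝔸] in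
/-- the kernel operator with transport, evaluated. [cite: Balaban1985BackgroundPropagators, (3.19) p.393, bookkeeping] -/
theorem kernelTrOpY_apply (K : X → X → ℝ) (T : X → X → 𝔸ˣ) (Λ : X → 𝔸) (z : X) :
    kernelTrOpY K T Λ z = ∑ w, ((K z w : ℝ) : ℂ) • R (T z w) (Λ w) := rfl

omit [CompleteSpace 𝔸] in
/-- with trivial transport the kernel operator is the lift of the kernel's matrix. [cite: Balaban1985BackgroundPropagators, p.395 («coincides with Δ_a … if U = 1»)] -/
theorem kernelTrOpY_one (K : X → X → ℝ) : kernelTrOpY K (fun _ _ => (1 : 𝔸ˣ)) = liftOpY 𝔸 (Matrix.of K) := by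
  refine LinearMap.ext fun Λ => funext fun z => ?_
  simp only [kernelTrOpY_apply, R_one, liftOpY, LinearMap.coe_mk, AddHom.coe_mk, Matrix.of_apply]

omit [Fintype X] [CompleteSpace 𝔸] in
/-- lifts add. [cite: Balaban1985BackgroundPropagators, (3.39) p.397, bookkeeping] -/
theorem liftY_add (f g : X → ℝ) (E : 𝔸) : liftY (f + g) E = liftY f E + liftY g E := by
  funext z; simp [liftY_apply, add_smul]

variable (𝔸)

omit [CompleteSpace 𝔸] in
/-- the lift adds. [cite: Balaban1985BackgroundPropagators, p.395, bookkeeping] -/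
theorem liftOpY_add (A B : Matrix X X ℝ) : liftOpY 𝔸 (A + B) = liftOpY 𝔸 A + liftOpY 𝔸 B := by
  refine linearMap_ext_of_liftY fun f E => ?_
  rw [LinearMap.add_apply, liftOpY_liftY, liftOpY_liftY, liftOpY_liftY, Matrix.add_mulVec, liftY_add]

variable {𝔸}

end General

/-! ## §2 The covariant Laplacian of the site sector as a ℂ-linear map -/

section Laplacian

variable (i : KIdx d ℓ hd hL b₀ b₁)

/-- `∇_{U,μ}` is additive. [cite: Balaban1985BackgroundPropagators, (3.3) p.390, bookkeeping] -/
theorem cdS_add (U : CfgY 𝔸 i) (μ : Fin (d + 1)) (Φ Ψ : SiteY i → 𝔸) : cdS i U μ (Φ + Ψ) = cdS i U μ Φ + cdS i U μ Ψ := by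
  funext z; exact B9Eq39Adjoint.covD_add _ _ μ Φ Ψ z

/-- `∇_{U,μ}` is ℂ-homogeneous. [cite: Balaban1985BackgroundPropagators, (3.3) p.390, bookkeeping] -/
theorem cdS_smul (U : CfgY 𝔸 i) (μ : Fin (d + 1)) (c : ℂ) (Φ : SiteY i → 𝔸) : cdS i U μ (c • Φ) = c • cdS i U μ Φ := by
  funext z; exact B9Eq39Adjoint.covD_smul _ _ c μ Φ z

/-- `∇*_{U,μ}` is additive. [cite: Balaban1985BackgroundPropagators, (3.8) p.392, bookkeeping] -/
theorem cdsS_add (U : CfgY 𝔸 i) (μ : Fin (d + 1)) (Φ Ψ : SiteY i → 𝔸) : cdsS i U μ (Φ + Ψ) = cdsS i U μ Φ + cdsS i U μ Ψ := by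
  funext z; exact B9Eq39Adjoint.covDstar_add _ _ μ Φ Ψ z

/-- `∇*_{U,μ}` is ℂ-homogeneous. [cite: Balaban1985BackgroundPropagators, (3.8) p.392, bookkeeping] -/
theorem cdsS_smul (U : CfgY 𝔸 i) (μ : Fin (d + 1)) (c : ℂ) (Φ : SiteY i → 𝔸) : cdsS i U μ (c • Φ) = c • cdsS i U μ Φ := by
  funext z; exact B9Eq39Adjoint.covDstar_smul _ _ c μ Φ z

/-- the covariant Laplacian is additive. [cite: Balaban1985BackgroundPropagators, (3.23) p.394, bookkeeping] -/
theorem lapS_add (U : CfgY 𝔸 i) (Φ Ψ : SiteY i → 𝔸) : lapS i U (Φ + Ψ) = lapS i U Φ + lapS i U Ψ := by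
  funext z
  simp only [lapS, Pi.add_apply, cdS_add, cdsS_add, Finset.sum_add_distrib]

/-- the covariant Laplacian is ℂ-homogeneous. [cite: Balaban1985BackgroundPropagators, (3.23) p.394, bookkeeping] -/
theorem lapS_smul (U : CfgY 𝔸 i) (c : ℂ) (Φ : SiteY i → 𝔸) : lapS i U (c • Φ) = c • lapS i U Φ := by
  funext z
  simp only [lapS, Pi.smul_apply, cdS_smul, cdsS_smul, Finset.smul_sum]

/-- ★ the covariant Laplacian `Δ_U = Σ_μ ∇*_{U,μ}∇_{U,μ}` of the site sector AS A ℂ-LINEAR MAP. [cite: Balaban1985BackgroundPropagators, (3.23) p.394] -/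
def lapSL (U : CfgY 𝔸 i) : (SiteY i → 𝔸) →ₗ[ℂ] (SiteY i → 𝔸) where
  toFun := lapS i U
  map_add' := lapS_add i U
  map_smul' := lapS_smul i U

/-- `lapSL` is `lapS`. [cite: Balaban1985BackgroundPropagators, (3.23) p.394, bookkeeping] -/
@[simp] theorem lapSL_apply (U : CfgY 𝔸 i) (Φ : SiteY i → 𝔸) : lapSL i U Φ = lapS i U Φ := rfl

/-- at `U = 1` the covariant Laplacian IS the lift of NODE 00's periodic Laplacian `perLapT` (as operators, not only on lifts).
[cite: Balaban1985BackgroundPropagators, p.395 («It coincides with Δ_a in (2.19) if U = 1»); Balaban1984PropagatorsII, (2.13) p.225] -/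
theorem lapSL_one : lapSL (𝔸 := 𝔸) i (fun _ _ => 1) = liftOpY 𝔸 (perLapT (toKT i).NB) := by
  refine linearMap_ext_of_liftY fun f E => ?_
  rw [lapSL_apply, lapS_one_liftY, liftOpY_liftY]

end Laplacian

/-! ## §3 The covariant multilevel operator `Δ′_a(U)` -/

section DeltaPrime

variable (i : KIdx d ℓ hd hL b₀ b₁)

/-- NODE 00's level function on the box chart: `lev z = j` iff `z ∈ B^j(Λ_j)`. [cite: Balaban1984PropagatorsII, (2.3)–(2.4) p.224, dictionary] -/
abbrev levY (z : SiteY i) : ℕ := (toKT i).D.lev z.1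

/-- the CORNER of the `L^j`-block of the box containing `z` (the block's reference point for the transport of the averaging term; print: the
block's centre `y`, (3.19)). [cite: Balaban1985BackgroundPropagators, (3.19) p.393, dictionary] -/
def cornerY (j : ℕ) (z : SiteY i) : SiteY i :=
  ⟨fun μ => (((ℓ + 1) ^ j : ℕ) : ℤ) * blk ((ℓ + 1) ^ j) z.1 μ, by
    rw [mem_boxDom]
    intro μ
    have hz := (mem_boxDom.1 z.2) μ
    have hb : (0 : ℤ) < (((ℓ + 1) ^ j : ℕ) : ℤ) := by positivity
    refine ⟨mul_nonneg hb.le (Int.ediv_nonneg hz.1 hb.le), lt_of_le_of_lt ?_ hz.2⟩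
    exact Int.mul_ediv_self_le hb.ne'⟩

/-- the corner, evaluated. [cite: Balaban1985BackgroundPropagators, (3.19) p.393, bookkeeping] -/
theorem cornerY_apply (j : ℕ) (z : SiteY i) (μ : Fin (d + 1)) :
    (cornerY i j z).1 μ = (((ℓ + 1) ^ j : ℕ) : ℤ) * blk ((ℓ + 1) ^ j) z.1 μ := rfl

/-- ★ NODE 00's AVERAGING COEFFICIENT at the index, collapsed form of `Σ_j a_j(L^jη)^{−2} Q′_j* 1_{Λ_j} Q′_j` (`mlOpT_apply`):
`levC_{lev z} · [w ∼_{lev z} z]` with the printed weights `a_j = aPrinted ℓ 1 j`. [cite: Balaban1984PropagatorsII, (2.13)–(2.14) p.225; Balaban1985BackgroundPropagators, (3.24) p.394] -/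
def avgCoeffY (z w : SiteY i) : ℝ := avgK (levC d ℓ (aPrinted ℓ 1) (levY i z)) ((ℓ + 1) ^ levY i z) z.1 w.1

/-- ★ the TRANSPORTER OF THE AVERAGING TERM: `U(Γ_{z,c}) · U(Γ_{c,w})` through the corner `c` of the common block (print: through the block's
reference point `y`, the adjoint `Q′_j(U)*` transporting `y → z` and `Q′_j(U)` transporting `w → y`). [cite: Balaban1985BackgroundPropagators, (3.19) p.393, (3.24) p.394] -/
def avgTrY (par : SiteParY 𝔸 i) (U : CfgY 𝔸 i) (z w : SiteY i) : 𝔸ˣ :=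
  par U z (cornerY i (levY i z) z) * par U (cornerY i (levY i z) z) w

/-- at `U = 1` (transporters `= 1`) the averaging transporter is `1`. [cite: Balaban1985BackgroundPropagators, Cor. 3.5 p.407 (U = 1), bookkeeping] -/
theorem avgTrY_one (par : SiteParY 𝔸 i) (hpar : ∀ z w, par (fun _ _ => 1) z w = 1) (z w : SiteY i) :
    avgTrY i par (fun _ _ => 1) z w = 1 := by
  rw [avgTrY, hpar, hpar, mul_one]

/-- ★★ **THE GENUINE COVARIANT OPERATOR `Δ′_a(U) = Δ_U + Σ_j a_j(L^jη)^{−2} Q′_j(U)* 1_{Λ_j} Q′_j(U)`** of (3.24) on the site sector of NODE 00's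
carrier, for a transporter letter `par`: the covariant Laplacian plus the transported averaging kernel.
[cite: Balaban1985BackgroundPropagators, (3.24) p.394; Balaban1984PropagatorsII, (2.13)–(2.14) p.225] -/
def deltaPrimeAY (par : SiteParY 𝔸 i) (U : CfgY 𝔸 i) : (SiteY i → 𝔸) →ₗ[ℂ] (SiteY i → 𝔸) :=
  lapSL i U + kernelTrOpY (avgCoeffY i) (avgTrY i par U)

/-- `Δ′_a(U)`, evaluated. [cite: Balaban1985BackgroundPropagators, (3.24) p.394, bookkeeping] -/
theorem deltaPrimeAY_apply (par : SiteParY 𝔸 i) (U : CfgY 𝔸 i) (Λ : SiteY i → 𝔸) (z : SiteY i) :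
    deltaPrimeAY i par U Λ z = lapS i U Λ z + ∑ w, ((avgCoeffY i z w : ℝ) : ℂ) • R (avgTrY i par U z w) (Λ w) := rfl

/-- NODE 00's matrix `Δ′_a` on the torus is the periodic Laplacian plus the averaging coefficient matrix (entrywise `mlOpT_apply`).
[cite: Balaban1984PropagatorsII, (2.13)–(2.14) p.225] -/
theorem mlOpT_eq_perLapT_add_avgCoeffY :
    mlOpT (toKT i).NB ℓ (toKT i).k (toKT i).D.lev (aPrinted ℓ 1) = perLapT (toKT i).NB + Matrix.of (avgCoeffY i) := by
  ext z w
  rw [B6MultiLevelTorusOperator.mlOpT_apply (toKT i).D rfl (aPrinted ℓ 1) z w, Matrix.add_apply, Matrix.of_apply]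
  rfl

/-- ★★ **THE PRINTED `U = 1` CLAUSE FOR `Δ′_a`** (p. 395 «It coincides with Δ_a in (2.19) if U = 1»): at the trivial configuration, for any
transporter letter with `par 1 = 1`, the covariant operator IS the lift of NODE 00's genuine matrix `mlOpT` (as operators).
[cite: Balaban1985BackgroundPropagators, p.395; Balaban1984PropagatorsII, (2.13)–(2.14) p.225] -/
theorem deltaPrimeAY_one (par : SiteParY 𝔸 i) (hpar : ∀ z w, par (fun _ _ => 1) z w = 1) :
    deltaPrimeAY i par (fun _ _ => 1) = liftOpY 𝔸 (mlOpT (toKT i).NB ℓ (toKT i).k (toKT i).D.lev (aPrinted ℓ 1)) := by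
  have htr : avgTrY i par (fun _ _ => 1) = fun _ _ => (1 : 𝔸ˣ) := funext fun z => funext fun w => avgTrY_one i par hpar z w
  rw [deltaPrimeAY, htr, kernelTrOpY_one, lapSL_one, mlOpT_eq_perLapT_add_avgCoeffY, liftOpY_add]

/-- the `U = 1` face on product-form arguments: `Δ′_a(1)(f ⊗ E) = (Δ′_a f) ⊗ E`. [cite: Balaban1985BackgroundPropagators, p.395; Balaban1984PropagatorsII, (2.13)–(2.14) p.225] -/
theorem deltaPrimeAY_one_liftY (par : SiteParY 𝔸 i) (hpar : ∀ z w, par (fun _ _ => 1) z w = 1) (f : SiteY i → ℝ) (E : 𝔸) :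
    deltaPrimeAY i par (fun _ _ => 1) (liftY f E) = liftY (mlOpT (toKT i).NB ℓ (toKT i).k (toKT i).D.lev (aPrinted ℓ 1) *ᵥ f) E := by
  rw [deltaPrimeAY_one i par hpar, liftOpY_liftY]

end DeltaPrime

/-! ## §4 The genuine letter `G′(U) = (Δ′_a(U))⁻¹` and its printed `U = 1` clause -/

section Gp

variable (i : KIdx d ℓ hd hL b₀ b₁)

/-- ★★ **THE GENUINE LETTER `G′(U) = (Δ′_a(U))⁻¹`** (p. 395 «Its inverse is denoted by G′, or G′(U)»): `Ring.inverse` in `End_ℂ(SiteY → 𝔸)` — the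
two-sided inverse where `Δ′_a(U)` is invertible (the regime of Thm 3.1), `0` elsewhere. [cite: Balaban1985BackgroundPropagators, (3.25) p.394, Thm 3.1 p.397] -/
def GpY (par : SiteParY 𝔸 i) : SiteOpY 𝔸 i := fun U => Ring.inverse (deltaPrimeAY i par U)

/-- `G′` is the inverse: `Δ′_a(U) G′(U) = 1` wherever `Δ′_a(U)` is invertible. [cite: Balaban1985BackgroundPropagators, p.395] -/
theorem deltaPrimeAY_mul_GpY (par : SiteParY 𝔸 i) (U : CfgY 𝔸 i) (hU : IsUnit (deltaPrimeAY i par U)) :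
    deltaPrimeAY i par U * GpY i par U = 1 :=
  Ring.mul_inverse_cancel _ hU

/-- `G′(U) Δ′_a(U) = 1` wherever `Δ′_a(U)` is invertible. [cite: Balaban1985BackgroundPropagators, p.395] -/
theorem GpY_mul_deltaPrimeAY (par : SiteParY 𝔸 i) (U : CfgY 𝔸 i) (hU : IsUnit (deltaPrimeAY i par U)) :
    GpY i par U * deltaPrimeAY i par U = 1 :=
  Ring.inverse_mul_cancel _ hU

/-- at `U = 1`, `Δ′_a(1)` is invertible (T1's `mlOpT` is a unit: `B9Cor35AtOneInverseLetters.isUnit_mlOpT`).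
[cite: Balaban1985BackgroundPropagators, p.395; Balaban1984PropagatorsII, p.225] -/
theorem isUnit_deltaPrimeAY_one (par : SiteParY 𝔸 i) (hpar : ∀ z w, par (fun _ _ => 1) z w = 1) :
    IsUnit (deltaPrimeAY i par (fun _ _ => 1)) :=
  isUnit_of_liftY_clause_mulVec (isUnit_mlOpT i) (deltaPrimeAY_one_liftY i par hpar)

/-- ★★ **THE PRINTED `U = 1` CLAUSE FOR `G′`** (Cor. 3.5 p. 407 «For operators with the external gauge field configuration U = 1, these theorems
are proved in [4]»): `G′(1)` IS the lift of NODE 00's genuine operator `KTIdx.G = gmlT = (Δ′_a)⁻¹` of (2.19) (as operators; the transfer through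
`Ring.inverse` is n06-g's `B9Cor35AtOneInverseLetters.eq_liftOpY_G_of_ringInverse`).
[cite: Balaban1985BackgroundPropagators, Cor. 3.5 p.407, p.395; Balaban1984PropagatorsII, p.225] -/
theorem GpY_one (par : SiteParY 𝔸 i) (hpar : ∀ z w, par (fun _ _ => 1) z w = 1) :
    GpY i par (fun _ _ => 1) = liftOpY 𝔸 (toKT i).G :=
  eq_liftOpY_G_of_ringInverse i (GpY i par) (deltaPrimeAY i par) rfl (deltaPrimeAY_one_liftY i par hpar)

/-- ★ the clause `CovLettersY.Gp_one` DISCHARGED for the genuine letter: `G′(1)(f ⊗ E) = (G f) ⊗ E`.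
[cite: Balaban1985BackgroundPropagators, Cor. 3.5 p.407; Balaban1984PropagatorsII, Prop. 2.2 p.234] -/
theorem GpY_one_liftY (par : SiteParY 𝔸 i) (hpar : ∀ z w, par (fun _ _ => 1) z w = 1) (f : SiteY i → ℝ) (E : 𝔸) :
    GpY i par (fun _ _ => 1) (liftY f E) = liftY ((toKT i).G *ᵥ f) E :=
  Gp_one_of_ringInverse_deltaPrimeA_one i (GpY i par) (deltaPrimeAY i par) rfl (deltaPrimeAY_one_liftY i par hpar) f E

end Gp

/-! ## §5 The upgrade of a letter family: `Gp` made genuine -/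

section Upgrade

variable (𝔸) {x : MemberY d ℓ hd hL b₀ b₁ Mstar}

/-- ★ the UPGRADE of a letter family: its `G′(U)` replaced by the genuine `GpY _ 𝔏.parS` (the clause `Gp_one` is now a theorem), every other
letter kept. [cite: Balaban1985BackgroundPropagators, (3.25) p.394, Cor. 3.5 p.407] -/
def CovLettersY.withGp (𝔏 : CovLettersY 𝔸 x) : CovLettersY 𝔸 x :=
  { 𝔏 with
    Gp := GpY x.toKIdx 𝔏.parS
    Gp_one := fun f E => GpY_one_liftY x.toKIdx 𝔏.parS 𝔏.parS_one f E }

variable {𝔸}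
variable (𝔏 : CovLettersY 𝔸 x)

/-- the upgraded `G′` is the genuine inverse. [cite: Balaban1985BackgroundPropagators, (3.25) p.394, bookkeeping] -/
@[simp] theorem CovLettersY.withGp_Gp : (𝔏.withGp 𝔸).Gp = GpY x.toKIdx 𝔏.parS := rfl
/-- the upgrade keeps the transporters. [cite: Balaban1985BackgroundPropagators, (3.40) p.397, bookkeeping] -/
@[simp] theorem CovLettersY.withGp_parS : (𝔏.withGp 𝔸).parS = 𝔏.parS := rfl
/-- the upgrade keeps the transporters. [cite: Balaban1985BackgroundPropagators, (3.40) p.397, bookkeeping] -/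
@[simp] theorem CovLettersY.withGp_parB : (𝔏.withGp 𝔸).parB = 𝔏.parB := rfl
/-- the upgrade keeps G(U). [cite: Balaban1985BackgroundPropagators, (3.27) p.395, bookkeeping] -/
@[simp] theorem CovLettersY.withGp_GA : (𝔏.withGp 𝔸).GA = 𝔏.GA := rfl
/-- the upgrade keeps C. [cite: Balaban1985BackgroundPropagators, (3.48) p.398, bookkeeping] -/
@[simp] theorem CovLettersY.withGp_C : (𝔏.withGp 𝔸).C = 𝔏.C := rfl

/-- the upgrade is idempotent. [cite: Balaban1985BackgroundPropagators, (3.25) p.394, bookkeeping] -/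
theorem CovLettersY.withGp_withGp : (𝔏.withGp 𝔸).withGp 𝔸 = 𝔏.withGp 𝔸 := rfl

variable (𝔸) (x)

/-- the flat letter family WITH GENUINE `G′` (an inhabitant whose `Gp` is `(Δ′_a(U))⁻¹`, transport flat).
[cite: Balaban1985BackgroundPropagators, (3.25) p.394, Cor. 3.5 p.407, dictionary] -/
def covLettersY_flatGp : CovLettersY 𝔸 x := (covLettersY_flat 𝔸 x).withGp 𝔸

/-- ★ the letter family with GENUINE TRANSPORT AND GENUINE `G′(U)`: `((covLettersY_flat).withTransport).withGp` — `parS ∕ parB` are the taxicab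
transporters `U(Γ)` of `Node00.OpsYTransport` and `Gp U = (Δ′_a(U))⁻¹` is built over them; the remaining letters (G, C, …) are still flat.
[cite: Balaban1985BackgroundPropagators, (3.25) p.394, (3.40) p.397, Cor. 3.5 p.407, dictionary] -/
def covLettersY_TGp : CovLettersY 𝔸 x := ((covLettersY_flat 𝔸 x).withTransport 𝔸).withGp 𝔸

/-- its `G′` is the genuine inverse over the genuine site transporter `parSY`. [cite: Balaban1985BackgroundPropagators, (3.25) p.394, bookkeeping] -/
theorem covLettersY_TGp_Gp : (covLettersY_TGp 𝔸 x).Gp = GpY x.toKIdx (parSY x.toKIdx) := rfl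

/-- its transporters are the genuine ones. [cite: Balaban1985BackgroundPropagators, (3.40) p.397, bookkeeping] -/
theorem covLettersY_TGp_parS : (covLettersY_TGp 𝔸 x).parS = parSY x.toKIdx := rfl

end Upgrade

end

end Literature.MathematicalPhysics.QuantumFieldTheory.Balaban1983to89.Node00
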